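import Summits.CriticalPhenomena.PercolationContinuityZ3.Theorems.PercNearOneGluingNoHeavyLowerTailThreePointProductFormBoxDisc

/-!
# The box theorem along HUB RUNS: the corrected hub column `m̂₊ = m₊ + t·(−39/800, 3/200, 0)`, the exact pair identity for
# `u ++ p^g ++ w` (every `g`), and an all-`g` positivity criterion from four rational inequalities on the two end states
# (Sahi programme, one-child boundary-star cycle, prover prim-sahi-p2 gen 74)

Support file (`--supports stmt-CriticalPhenomena-4575`).  Standard axioms, no sorries, no named facts.  Memo
`run/shared/lean/prim/prim-sahi/FROM-prim-sahi-p2-gen74-HUB-RUNS.md`, `prim-sahi-p2/PROOF-E3.md` §84.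

THE OBJECT.  `boxval w` (`…ProductFormBoxPair`) is the AM form `A = #P1 + #P2 − 2·#bad` of the one-child boundary-star cycle read on the
12-state normal form; the box theorem (★) is `0 ≤ boxval w` for every physical word.  This file isolates the EXACT structure of (★) along
a hub run `p^g = (1,0)^g` inserted anywhere in the word:

* `colPhat` — the CORRECTED HUB COLUMN `m̂₊ := m₊ + t·w`, `w = (−39/800, 3/200, 0)`: the unique `t`-shift of `m₊ = colP` that moves
  HOMOGENEOUSLY under the hub letter (`colPhat_hub`: `m̂₊(N_{(s,0)}v) = s²·P𝕄(m̂₊(v))`; `w` solves `(P𝕄 − ¾)w = J₊(p)`), while `m₋ = colM`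
  and `m³ = col3` are hub-homogeneous as they stand (`colM_hub`, `col3_hub`);
* `betaM_corr` — `β𝕄(w, a) = −(3/6400)·ψ₂₃(a)`, so the cross term `−(45/8)(t·ψ₂₃(m'₋) + t'·ψ₂₃(m₋))` of the pair form `kA_coords`
  (`…ProductFormKrein`) is ABSORBED: ★ `kA_coords_hat`
  `β_a(v,v') = (117/64)tt' + (135/112)(tG' + Gt') + 12000[β𝕄(m̂₊,m'₋) + β𝕄(m₋,m̂'₊)]` (`G = −Λ − (7/30)t ≥ 0`, LEMMA Λ), and
  ★ `boxval_append_hat`: `A[u++w] = (117/64)tt' + (135/112)(tG'+Gt') + 12000[β𝕄(m̂₊,m'₋) + β𝕄(m₋,m̂'₊)] + 300β𝕄(m³,m'³) − 12εε'`;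
* ★ `boxval_hubRun` — THE HUB-RUN PAIR IDENTITY, every `g`:
  `A[u ++ p^g ++ w] = (3/4)^g·[(117/64)tt' + (135/112)(tG'+Gt') + (9/32)·g·tt'] + 12000[β𝕄(m̂₊, P^g m'₋) + β𝕄(m₋, P^g m̂'₊)] + 300β𝕄(m³, P^g m'³) − 12εε'`
  (the `(t, G)` Jordan block of eigenvalue `3/4`, three module pairings, the constant `ε`-term);
* `betaE_actP_two` — on the plane part `β_E` of `β𝕄` the hub letter satisfies Cayley–Hamilton `P² = (15/4)P − (5/2)`, so every pairing
  `g ↦ β_E(P^g a, b)` is a two-term recurrence (roots `λ± = (15 ± √65)/8`), and the `z`-parts are `(5/4)^g·a_z b_z` (`betaM_iterate_actP`);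
* `twoTerm_mono` — a rational positivity lemma for `h_{g+2} = (15/4)h_{g+1} − (5/2)h_g`: if `0 ≤ h₀` and `ρh₀ ≤ h₁` with `7/8 ≤ ρ ≤ 2`
  (any `ρ` between the roots works) then `0 ≤ h_g` and `ρ h_g ≤ h_{g+1}` for all `g`;
* ★★ `boxval_hubRun_nonneg_of_criterion` — THE HUB-RUN CRITERION: for nonempty physical `u, w` with end states `ũ = state(reverse u)`,
  `w = state(w)`, let `E_g` be the plane part and `Z·(5/4)^g` the `z`-part of the three module pairings; if `0 ≤ E₀`, `(5/4)E₀ ≤ E₁` and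
  `12εε' ≤ E₀ + Z`, then `0 ≤ A[u ++ p^g ++ w]` for EVERY `g ≥ 0` — three rational inequalities on two states settle an infinite family
  (they hold for 19 991 of 20 000 random pairs of physical words of length ≥ 3; the exceptions are near-hub pairs).
Asymptotically (memo §1) `E_g/λ₊^g → c₊·[12000(a₊a'₋ + a₋a'₊) + 300a₃a'₃]` with the `λ₊`-amplitudes `a₊ = L₊(m̂₊) = L₊(m₊) − κt`
(`κ = 0.0055083`), `a₋ = L₊(m₋)`, `a₃ = L₊(m³)`, `L₊ = (1, λ₊, 0)`: the corrected column is exactly the one whose `L₊`-readout is the limit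
amplitude, and the sharp amplitude law `a₃² ≤ 40x*·a₊a₋` (`40x* = 40.58 < 80`, flat in depth) is the `g → ∞` shadow of (★).  [this work] (gen 74).
-/

namespace Summit.CriticalPhenomena.PercolationContinuityZ3.Theorems.ProductFormABPlus

open ProductFormCorners (V3)

/-! ### 1. The corrected hub column and the corrected pair form -/

/-- The corrected hub column `m̂₊ = m₊ + t·(−39/800, 3/200, 0)`. [this work] -/
def colPhat (v : StA) : V3 := ⟨(colP v).x - (39/800) * v.t, (colP v).y + (3/200) * v.t, (colP v).z⟩

/-- The plane (Hankel) part of the module form: `β𝕄(a,b) = β_E(a,b) + a_z b_z`. [this work] -/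
def betaE (a b : V3) : ℚ := (3/4) * a.x * b.x + (37/16) * (a.x * b.y + a.y * b.x) + (435/64) * a.y * b.y

/-- `β𝕄 = β_E ⊕ 1`. [this work] -/
theorem betaM_eq_betaE (a b : V3) : betaM a b = betaE a b + a.z * b.z := by
  unfold betaM betaE; ring

/-- `β_E` is symmetric. [this work] -/
theorem betaE_symm (a b : V3) : betaE a b = betaE b a := by unfold betaE; ring

/-- The correction vector pairs to `−(3/6400)·ψ₂₃`: `β𝕄((−39/800, 3/200, 0), a) = −(3/6400)·ψ₂₃(a)` — this is why the cross term
`−(45/8)·t·ψ₂₃(m'₋)` of `kA_coords` is absorbed by `m̂₊` (`12000 · 3/6400 = 45/8`). [this work] -/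
theorem betaM_corr (a : V3) : betaM ⟨-(39/800), 3/200, 0⟩ a = -(3/6400) * psi23 a := by
  simp only [betaM, psi23]; ring

/-- ★ THE CORRECTED PAIR FORM: `β_a(v,v') = (117/64)tt' + (135/112)(tG' + Gt') + 12000[β𝕄(m̂₊,m'₋) + β𝕄(m₋,m̂'₊)]`
(`G = (zOf ·).G = −Λ − (7/30)t`). [this work] -/
theorem kA_coords_hat (v w : StA) :
    kA v w = (117/64) * v.t * w.t + (135/112) * (v.t * (zOf w).G + (zOf v).G * w.t)
      + 12000 * (betaM (colPhat v) (colM w) + betaM (colM v) (colPhat w)) := by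
  simp only [kA, colPhat, colP, colM, zOf, Lam, betaM]; ring

/-- ★ THE CORRECTED PHYSICAL PAIR IDENTITY: for all words `u, w`, with `v = state(reverse u)`, `v' = state(w)`:
`A[u ++ w] = (117/64)tt' + (135/112)(tG' + Gt') + 12000[β𝕄(m̂₊,m'₋) + β𝕄(m₋,m̂'₊)] + 300β𝕄(m³,m'³) − 12εε'`. [this work] -/
theorem boxval_append_hat (u w : List (ℚ × ℚ)) :
    boxval (u ++ w) =
      (117/64) * (brunA u.reverse omegaA).t * (brunA w omegaA).t
      + (135/112) * ((brunA u.reverse omegaA).t * (zOf (brunA w omegaA)).G + (zOf (brunA u.reverse omegaA)).G * (brunA w omegaA).t)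
      + 12000 * (betaM (colPhat (brunA u.reverse omegaA)) (colM (brunA w omegaA))
          + betaM (colM (brunA u.reverse omegaA)) (colPhat (brunA w omegaA)))
      + (300 * betaM (col3 (brunB u.reverse omegaB)) (col3 (brunB w omegaB))
          - 12 * (brunB u.reverse omegaB).E4 * (brunB w omegaB).E4) := by
  rw [boxval_append, kA_coords_hat, kB_coords]

/-- The one-sided value in the corrected coordinates: `α_a(v) = (33/8)t + (45/14)G − 15ψ₂₃(m₋)` and `ψ₂₃(m₋) = −(6400/3)·β𝕄(w, m₋)`,
recorded as `α_a(v) = (33/8)t + (45/14)G + 32000·β𝕄((−39/800,3/200,0), m₋(v))`. [this work] -/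
theorem alphaA_hat (v : StA) :
    alphaA v = (33/8) * v.t + (45/14) * (zOf v).G + 32000 * betaM ⟨-(39/800), 3/200, 0⟩ (colM v) := by
  simp only [alphaA, zOf, Lam, betaM, colM]; ring

/-! ### 2. The hub letter `(s, 0)`: homogeneity of `m̂₊, m₋, m³, ε`, the `(t, G)` Jordan block -/

/-- `t ↦ (3/4)s²·t` under the hub letter. [this work] -/
theorem t_hub (s : ℚ) (v : StA) : (bstepA s 0 v).t = (3/4) * s ^ 2 * v.t := by
  simp only [bstepA, combA, stepA]; ring

/-- `G ↦ s²·((3/4)G + (7/40)t)` under the hub letter (the `(t,G)` Jordan block of eigenvalue `3/4`). [this work] -/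
theorem G_hub (s : ℚ) (v : StA) : (zOf (bstepA s 0 v)).G = s ^ 2 * ((3/4) * (zOf v).G + (7/40) * v.t) := by
  simp only [zOf, bstepA, combA, stepA, Lam]; ring

/-- ★ The corrected hub column is HOMOGENEOUS under the hub letter: `m̂₊(N_{(s,0)}v) = s²·P𝕄(m̂₊(v))`. [this work] -/
theorem colPhat_hub (s : ℚ) (v : StA) :
    colPhat (bstepA s 0 v) = ⟨s ^ 2 * (actP (colPhat v)).x, s ^ 2 * (actP (colPhat v)).y, s ^ 2 * (actP (colPhat v)).z⟩ := by
  simp only [colPhat, colP, bstepA, combA, stepA, actP]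
  ext <;> simp only <;> ring

/-- `m₋` is homogeneous under the hub letter (no visible injection at the hub). [this work] -/
theorem colM_hub (s : ℚ) (v : StA) :
    colM (bstepA s 0 v) = ⟨s ^ 2 * (actP (colM v)).x, s ^ 2 * (actP (colM v)).y, s ^ 2 * (actP (colM v)).z⟩ := by
  simp only [colM, bstepA, combA, stepA, actP]
  ext <;> simp only <;> ring

/-- `m³` is homogeneous under every letter, in particular the hub letter. [this work] -/
theorem col3_hub (s : ℚ) (u : StB) :
    col3 (bstepB s 0 u) = ⟨s ^ 2 * (actP (col3 u)).x, s ^ 2 * (actP (col3 u)).y, s ^ 2 * (actP (col3 u)).z⟩ := by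
  simp only [col3, bstepB, combB, stepB, actP]
  ext <;> simp only <;> ring

/-- `ε ↦ s²·ε` under the hub letter. [this work] -/
theorem E4_hub (s : ℚ) (u : StB) : (bstepB s 0 u).E4 = s ^ 2 * u.E4 := by
  simp only [bstepB, combB, stepB]; ring

/-! ### 3. Hub runs `p^g = (1,0)^g` -/

/-- The hub run of length `g`: `g` copies of the hub letter `(s,d) = (1,0)`. [this work] -/
def hubRun (g : ℕ) : List (ℚ × ℚ) := List.replicate g (1, 0)

/-- Hub runs are physical. [this work] -/
theorem hubRun_physical (g : ℕ) : ∀ θ ∈ hubRun g, 0 ≤ θ.1 + θ.2 ∧ 0 ≤ θ.1 - θ.2 := by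
  intro θ hθ
  rw [hubRun, List.mem_replicate] at hθ
  rw [hθ.2]; norm_num

/-- `|p^g| = g`. [this work] -/
theorem hubRun_length (g : ℕ) : (hubRun g).length = g := by simp [hubRun]

/-- The `a`-state after a hub run: `t ↦ (3/4)^g t`, `G ↦ (3/4)^g (G + (7/30)·g·t)`, `m̂₊ ↦ P^g m̂₊`, `m₋ ↦ P^g m₋`. [this work] -/
theorem brunA_hubRun (g : ℕ) (v : StA) :
    (brunA (hubRun g) v).t = (3/4 : ℚ) ^ g * v.t ∧
    (zOf (brunA (hubRun g) v)).G = (3/4 : ℚ) ^ g * ((zOf v).G + (7/30) * (g : ℚ) * v.t) ∧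
    colPhat (brunA (hubRun g) v) = actP^[g] (colPhat v) ∧
    colM (brunA (hubRun g) v) = actP^[g] (colM v) := by
  induction g with
  | zero =>
    simp only [hubRun, List.replicate, brunA, pow_zero, one_mul, Function.iterate_zero, id_eq, Nat.cast_zero, mul_zero,
      zero_mul, add_zero, and_self]
  | succ g ih =>
    obtain ⟨ht, hG, hP, hM⟩ := ih
    have hstep : brunA (hubRun (g + 1)) v = bstepA 1 0 (brunA (hubRun g) v) := by
      simp only [hubRun, List.replicate_succ, brunA]
    rw [hstep]
    refine ⟨?_, ?_, ?_, ?_⟩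
    · rw [t_hub, ht]; ring
    · rw [G_hub, hG, ht]; push_cast; ring
    · rw [colPhat_hub, hP, Function.iterate_succ_apply']
      ext <;> simp
    · rw [colM_hub, hM, Function.iterate_succ_apply']
      ext <;> simp

/-- The `b`-state after a hub run: `m³ ↦ P^g m³`, `ε ↦ ε`. [this work] -/
theorem brunB_hubRun (g : ℕ) (u : StB) :
    col3 (brunB (hubRun g) u) = actP^[g] (col3 u) ∧ (brunB (hubRun g) u).E4 = u.E4 := by
  induction g with
  | zero => simp [hubRun, brunB]
  | succ g ih =>
    obtain ⟨h3, h4⟩ := ih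
    have hstep : brunB (hubRun (g + 1)) u = bstepB 1 0 (brunB (hubRun g) u) := by
      simp only [hubRun, List.replicate_succ, brunB]
    rw [hstep]
    refine ⟨?_, ?_⟩
    · rw [col3_hub, h3, Function.iterate_succ_apply']
      ext <;> simp
    · rw [E4_hub, h4]; ring

/-- ★ THE HUB-RUN PAIR IDENTITY (every `g`).  With `v = state(reverse u)`, `v' = state(w)` (and `m'… = columns of v'`):
`A[u ++ p^g ++ w] = (3/4)^g·[(117/64)tt' + (135/112)(tG' + Gt') + (9/32)·g·tt'] + 12000[β𝕄(m̂₊, P^g m'₋) + β𝕄(m₋, P^g m̂'₊)]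
  + 300·β𝕄(m³, P^g m'³) − 12εε'`. [this work] -/
theorem boxval_hubRun (u w : List (ℚ × ℚ)) (g : ℕ) :
    boxval (u ++ (hubRun g ++ w)) =
      (3/4 : ℚ) ^ g * ((117/64) * (brunA u.reverse omegaA).t * (brunA w omegaA).t
        + (135/112) * ((brunA u.reverse omegaA).t * (zOf (brunA w omegaA)).G + (zOf (brunA u.reverse omegaA)).G * (brunA w omegaA).t)
        + (9/32) * (g : ℚ) * (brunA u.reverse omegaA).t * (brunA w omegaA).t)
      + 12000 * (betaM (colPhat (brunA u.reverse omegaA)) (actP^[g] (colM (brunA w omegaA)))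
          + betaM (colM (brunA u.reverse omegaA)) (actP^[g] (colPhat (brunA w omegaA))))
      + (300 * betaM (col3 (brunB u.reverse omegaB)) (actP^[g] (col3 (brunB w omegaB)))
          - 12 * (brunB u.reverse omegaB).E4 * (brunB w omegaB).E4) := by
  rw [boxval_append_hat, brunA_append, brunB_append]
  obtain ⟨ht, hG, hP, hM⟩ := brunA_hubRun g (brunA w omegaA)
  obtain ⟨h3, h4⟩ := brunB_hubRun g (brunB w omegaB)
  rw [ht, hG, hP, hM, h3, h4]
  ring

/-! ### 4. The two-term recurrence of the plane pairings and a rational positivity lemma -/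

/-- Cayley–Hamilton for the hub letter on the plane: `β_E(P(Pa), b) = (15/4)·β_E(Pa, b) − (5/2)·β_E(a, b)`. [this work] -/
theorem betaE_actP_two (a b : V3) : betaE (actP (actP a)) b = (15/4) * betaE (actP a) b - (5/2) * betaE a b := by
  simp only [betaE, actP]; ring

/-- The `z`-coordinate is the `5/4`-character of the hub letter: `(P^g a)_z = (5/4)^g a_z`. [this work] -/
theorem iterate_actP_z (g : ℕ) (a : V3) : (actP^[g] a).z = (5/4 : ℚ) ^ g * a.z := by
  induction g with
  | zero => simp
  | succ g ih => rw [Function.iterate_succ_apply', pow_succ]; simp only [actP]; rw [ih]; ring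

/-- `β𝕄(a, P^g b) = β_E(P^g b, a) + (5/4)^g a_z b_z`: plane recurrence part plus the `z`-character. [this work] -/
theorem betaM_iterate_actP (g : ℕ) (a b : V3) :
    betaM a (actP^[g] b) = betaE (actP^[g] b) a + (5/4 : ℚ) ^ g * a.z * b.z := by
  rw [betaM_symm, betaM_eq_betaE, iterate_actP_z]; ring

/-- The plane pairing along a hub run is a two-term recurrence: `h_{g+2} = (15/4)h_{g+1} − (5/2)h_g` for `h_g = β_E(P^g b, a)`. [this work] -/
theorem betaE_iterate_rec (a b : V3) (g : ℕ) :
    betaE (actP^[g + 2] b) a = (15/4) * betaE (actP^[g + 1] b) a - (5/2) * betaE (actP^[g] b) a := by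
  rw [show g + 2 = (g + 1) + 1 from rfl, Function.iterate_succ_apply', Function.iterate_succ_apply', betaE_actP_two]

/-- ★ RATIONAL POSITIVITY FOR THE HUB RECURRENCE.  If `h_{g+2} = (15/4)h_{g+1} − (5/2)h_g`, `0 ≤ h₀` and `ρ·h₀ ≤ h₁` for some `ρ` with
`7/8 ≤ ρ ≤ 2` (so `4ρ² − 15ρ + 10 ≤ 0`: `ρ` lies between the roots `λ± = (15 ± √65)/8`), then `0 ≤ h_g` and `ρ·h_g ≤ h_{g+1}` for every `g`
(hence `h_g ≥ ρ^g h₀`). [this work] -/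
theorem twoTerm_mono (h : ℕ → ℚ) (ρ : ℚ) (hρ1 : 7/8 ≤ ρ) (hρ2 : ρ ≤ 2)
    (rec : ∀ g, h (g + 2) = (15/4) * h (g + 1) - (5/2) * h g) (h0 : 0 ≤ h 0) (h1 : ρ * h 0 ≤ h 1) :
    ∀ g, 0 ≤ h g ∧ ρ * h g ≤ h (g + 1) := by
  intro g
  induction g with
  | zero => exact ⟨h0, h1⟩
  | succ g ih =>
    obtain ⟨hg, hg1⟩ := ih
    have hpos : 0 ≤ h (g + 1) := by nlinarith
    refine ⟨hpos, ?_⟩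
    rw [show g + 1 + 1 = g + 2 from rfl, rec g]
    -- (15/4 − ρ)·h_{g+1} ≥ (15/4 − ρ)·ρ·h_g ≥ (5/2)·h_g because (15/4 − ρ)ρ − 5/2 = −(4ρ² − 15ρ + 10)/4 ≥ 0
    have hq : 0 ≤ -(4 * ρ ^ 2 - 15 * ρ + 10) := by nlinarith
    have hA : (15/4 - ρ) * (ρ * h g) ≤ (15/4 - ρ) * h (g + 1) := mul_le_mul_of_nonneg_left hg1 (by linarith)
    nlinarith [mul_nonneg hq hg]

/-- Growth form: under the hypotheses of `twoTerm_mono`, `ρ^g·h₀ ≤ h_g` for every `g`. [this work] -/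
theorem twoTerm_growth (h : ℕ → ℚ) (ρ : ℚ) (hρ1 : 7/8 ≤ ρ) (hρ2 : ρ ≤ 2)
    (rec : ∀ g, h (g + 2) = (15/4) * h (g + 1) - (5/2) * h g) (h0 : 0 ≤ h 0) (h1 : ρ * h 0 ≤ h 1) :
    ∀ g, ρ ^ g * h 0 ≤ h g := by
  intro g
  induction g with
  | zero => simp
  | succ g ih =>
    have hstep := (twoTerm_mono h ρ hρ1 hρ2 rec h0 h1 g).2
    have hρ0 : 0 ≤ ρ := by linarith
    calc ρ ^ (g + 1) * h 0 = ρ * (ρ ^ g * h 0) := by ring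
      _ ≤ ρ * h g := mul_le_mul_of_nonneg_left ih hρ0
      _ ≤ h (g + 1) := hstep

/-! ### 5. The hub-run criterion -/

/-- The plane part `E_g` of the three module pairings of `A[u ++ p^g ++ w]` (a two-term recurrence in `g`). [this work] -/
def hubE (v : StA) (b : StB) (v' : StA) (b' : StB) (g : ℕ) : ℚ :=
  12000 * (betaE (actP^[g] (colM v')) (colPhat v) + betaE (actP^[g] (colPhat v')) (colM v))
    + 300 * betaE (actP^[g] (col3 b')) (col3 b)

/-- The `z`-part coefficient `Z` (the `5/4`-character): `12000[(m̂₊)_z(m'₋)_z + (m₋)_z(m̂'₊)_z] + 300·ζζ'`. [this work] -/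
def hubZ (v : StA) (b : StB) (v' : StA) (b' : StB) : ℚ :=
  12000 * ((colPhat v).z * (colM v').z + (colM v).z * (colPhat v').z) + 300 * (col3 b).z * (col3 b').z

/-- `E_g` satisfies the hub recurrence. [this work] -/
theorem hubE_rec (v : StA) (b : StB) (v' : StA) (b' : StB) (g : ℕ) :
    hubE v b v' b' (g + 2) = (15/4) * hubE v b v' b' (g + 1) - (5/2) * hubE v b v' b' g := by
  simp only [hubE, betaE_iterate_rec]; ring

/-- The module part of the hub-run identity splits as `E_g + (5/4)^g·Z`. [this work] -/
theorem hub_module_split (v : StA) (b : StB) (v' : StA) (b' : StB) (g : ℕ) :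
    12000 * (betaM (colPhat v) (actP^[g] (colM v')) + betaM (colM v) (actP^[g] (colPhat v')))
      + 300 * betaM (col3 b) (actP^[g] (col3 b')) = hubE v b v' b' g + (5/4 : ℚ) ^ g * hubZ v b v' b' := by
  simp only [betaM_iterate_actP, hubE, hubZ]; ring

/-- ★★ THE HUB-RUN CRITERION.  Let `u, w` be NONEMPTY physical words, `v = state(reverse u)`, `v' = state(w)` (with their `b`-parts),
`E_g` the plane part and `Z·(5/4)^g` the `z`-part of the three module pairings, `ε, ε'` the two `E4`-coordinates.  If
`0 ≤ E₀`, `(5/4)·E₀ ≤ E₁` and `12εε' ≤ E₀ + Z`, then `0 ≤ A[u ++ p^g ++ w]` for EVERY `g ≥ 0`: three rational inequalities on the two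
end states settle the whole infinite family of cycle words with a hub run of any length between the ends.  (The `(t,G)`-part is `≥ 0` by
LEMMA Λ and `t ≥ 0`; `E_g ≥ (5/4)^g E₀` by `twoTerm_growth` with `ρ = 5/4`; so the module part is `≥ (5/4)^g (E₀ + Z) ≥ 12εε'`.)
Numerically (memo §2) the hypotheses hold for 99.9 % of random pairs of physical words of length `≥ 3` (19 991 / 20 000) and 89 % of all
short pairs; the failures are the near-hub pairs (`E₀ < 0` or `E₀ + Z < 12εε'`), the binding regime of (★). [this work] -/
theorem boxval_hubRun_nonneg_of_criterion (u w : List (ℚ × ℚ))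
    (hu : ∀ θ ∈ u, 0 ≤ θ.1 + θ.2 ∧ 0 ≤ θ.1 - θ.2) (hw : ∀ θ ∈ w, 0 ≤ θ.1 + θ.2 ∧ 0 ≤ θ.1 - θ.2)
    (hune : u ≠ []) (hwne : w ≠ [])
    (hE0 : 0 ≤ hubE (brunA u.reverse omegaA) (brunB u.reverse omegaB) (brunA w omegaA) (brunB w omegaB) 0)
    (hE1 : (5/4) * hubE (brunA u.reverse omegaA) (brunB u.reverse omegaB) (brunA w omegaA) (brunB w omegaB) 0 ≤
      hubE (brunA u.reverse omegaA) (brunB u.reverse omegaB) (brunA w omegaA) (brunB w omegaB) 1)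
    (hEps : 12 * (brunB u.reverse omegaB).E4 * (brunB w omegaB).E4 ≤
      hubE (brunA u.reverse omegaA) (brunB u.reverse omegaB) (brunA w omegaA) (brunB w omegaB) 0
        + hubZ (brunA u.reverse omegaA) (brunB u.reverse omegaB) (brunA w omegaA) (brunB w omegaB))
    (g : ℕ) : 0 ≤ boxval (u ++ (hubRun g ++ w)) := by
  set v := brunA u.reverse omegaA with hv
  set b := brunB u.reverse omegaB with hb
  set v' := brunA w omegaA with hv'
  set b' := brunB w omegaB with hb'
  have hur : ∀ θ ∈ u.reverse, 0 ≤ θ.1 + θ.2 ∧ 0 ≤ θ.1 - θ.2 := physical_reverse hu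
  have hurne : u.reverse ≠ [] := by simpa using hune
  have ht : 0 ≤ v.t := t_brunA_nonneg u.reverse hur
  have ht' : 0 ≤ v'.t := t_brunA_nonneg w hw
  have hG : 0 ≤ (zOf v).G := zOfG_nonneg u.reverse hur hurne
  have hG' : 0 ≤ (zOf v').G := zOfG_nonneg w hw hwne
  have hee : 0 ≤ b.E4 * b'.E4 := mul_nonneg (E4_brunB_nonneg _) (E4_brunB_nonneg _)
  -- the recurrence part: E_g ≥ (5/4)^g E_0
  have hgrow := twoTerm_growth (hubE v b v' b') (5/4) (by norm_num) (by norm_num) (hubE_rec v b v' b') hE0 hE1 g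
  have hpow : (1 : ℚ) ≤ (5/4 : ℚ) ^ g := one_le_pow₀ (by norm_num)
  have hsum : 0 ≤ hubE v b v' b' 0 + hubZ v b v' b' := le_trans (by nlinarith) hEps
  have hmod : hubE v b v' b' 0 + hubZ v b v' b' ≤ hubE v b v' b' g + (5/4 : ℚ) ^ g * hubZ v b v' b' := by
    have h1 : (5/4 : ℚ) ^ g * (hubE v b v' b' 0 + hubZ v b v' b') ≤ hubE v b v' b' g + (5/4 : ℚ) ^ g * hubZ v b v' b' := by
      nlinarith
    nlinarith
  have hsplit := hub_module_split v b v' b' g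
  have h34 : 0 ≤ (3/4 : ℚ) ^ g := pow_nonneg (by norm_num) g
  have hg0 : (0 : ℚ) ≤ (g : ℚ) := Nat.cast_nonneg g
  rw [boxval_hubRun]
  have hTG : 0 ≤ (117/64) * v.t * v'.t + (135/112) * (v.t * (zOf v').G + (zOf v).G * v'.t) + (9/32) * (g : ℚ) * v.t * v'.t := by
    have := mul_nonneg ht ht'
    nlinarith [mul_nonneg ht hG', mul_nonneg hG ht', mul_nonneg hg0 this]
  nlinarith [mul_nonneg h34 hTG]

/-- Sanity: the empty ends give the hub cycle, `A[p^g] = (2g+9)(3/4)^g + 3(5/4)^g − 12` (the closed form of `…ProductFormABPlus`,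
here from the hub-run identity: `t = t' = 8/3`, `G = G' = −28/45`, `m̂₊ = (8/3)w`, `m₋ = 0`, `m³ = (0,0,−1/10)`, `ε = 1`). [this work] -/
theorem boxval_hubRun_nil (g : ℕ) :
    boxval (hubRun g) = (2 * (g : ℚ) + 9) * (3/4 : ℚ) ^ g + 3 * (5/4 : ℚ) ^ g - 12 := by
  have h := boxval_hubRun [] [] g
  simp only [List.nil_append, List.append_nil, List.reverse_nil, brunA, brunB] at h
  rw [h, betaM_iterate_actP, betaM_iterate_actP, betaM_iterate_actP]
  have hz : ∀ n : ℕ, actP^[n] (colM omegaA) = ⟨0, 0, 0⟩ := by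
    intro n; induction n with
    | zero => simp [colM, omegaA]
    | succ n ih => rw [Function.iterate_succ_apply', ih]; simp [actP]
  have hM0 : colM omegaA = ⟨0, 0, 0⟩ := by simp [colM, omegaA]
  rw [hz g, hM0]
  simp only [betaE, colPhat, colP, col3, omegaA, omegaB, zOf, Lam]
  ring

end Summit.CriticalPhenomena.PercolationContinuityZ3.Theorems.ProductFormABPlus
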